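import Literature.AlgebraicGeometry.HodgeTheory.RankOneCentreTimesCMCurveProductSpan
import Literature.AlgebraicGeometry.HodgeTheory.SimpleCMSurfaceNoQuadraticSkewSquare
import Literature.AlgebraicGeometry.HodgeTheory.SimpleAbelianThreefoldQuadraticEndPowersHodgeClasses
import Literature.AlgebraicGeometry.HodgeTheory.BettiUniverseCMTypes
import Literature.AlgebraicGeometry.HodgeTheory.EllipticCurvesProductsHodgeClassesOfRiemann
import Literature.AlgebraicGeometry.HodgeTheory.AbelianVarietyHodgeFullnessHolds
import Literature.AlgebraicGeometry.ComplexMultiplication.CommonReflexSpan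
import Literature.AlgebraicGeometry.Motives.HodgeThetaAnnihilatorRankOneCentreTimesQSimpleTorus
import Literature.AlgebraicGeometry.Motives.HodgeTensorAnnihilatorDiagonalTransfer
import Literature.AlgebraicGeometry.Motives.HodgeEndActionEigenlineSkewCommutant
import Literature.AlgebraicGeometry.Motives.HodgeStructureCMCompatiblePolarization
import Literature.NumberTheory.ComplexMultiplication.QuarticCMUnitaryTorusQSimple
import HarnessLib

/-!
# `A × S`, `End⁰(A)` imaginary quadratic, `S` a simple CM abelian surface: invariance, product span, condition (D), and the row `S_CM × T` of Moonen–Zarhin's Thm. 0.2 (4) (Lemma (3.6): `Hg(S)` is a `ℚ`-simple torus of dimension two; §5 (5.10))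

Family `hodge`, layer `Literature/AlgebraicGeometry/HodgeTheory`. Research context: cell `pub-hodge-ring2` (HONEST
FRAMING: research route conditional on HC_CM; not a corollary; Q11.4-sentence-2 already refuted in dim ≥ 3),
Literature lane, programme R28b — geometric half, the sequel of the abstract Lie step
`Motives/HodgeThetaAnnihilatorRankOneCentreTimesQSimpleTorus` (Moonen–Zarhin Lemma (3.6) for a `ℚ`-simple rank-two
torus against a centre of rank one), of the skew-commutant theorem `Motives/HodgeEndActionEigenlineSkewCommutant`, the
word-model transfer `Motives/HodgeTensorAnnihilatorDiagonalTransfer`, the Galois input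
`NumberTheory/ComplexMultiplication/QuarticCMUnitaryTorusQSimple`, and `SimpleCMSurfaceNoQuadraticSkewSquare`.
UNCONDITIONAL (no HC_CM); theorems only (no definition, no named fact, D-0026; nothing admitted); no step towards a
summit statement beyond the printed results it formalizes.

PRINTED RESULTS. B. Moonen, Yu. Zarhin, *Hodge classes on abelian varieties of low dimension*, Math. Ann. 315 (1999)
[held: `paper:arxiv-math_9901113`, locators = held TeX chunks]: §3 Lemma (3.6) (chunk p0007) «Let `X₁` and `X₂` be
nonzero complex abelian varieties. Assume that the Hodge group `Hg(X₂)` is a `ℚ`-simple algebraic torus. (In particular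
`X₂` is of CM-type.) Write `X = X₁ × X₂`. If `Hg(X) ≠ Hg(X₁) × Hg(X₂)` then the center of `Hg(X₁)` contains an algebraic
torus which is `ℚ`-isogenous to `Hg(X₂)`»; §3 (3.1) and Thm. (3.2) (chunk p0006); Thm. 0.2 (4) (chunks p0001–p0002)
«if `X` has no simple factor of dimension 4 then `B•(Xⁿ) = D•(Xⁿ)` for every `n ≥ 1`»; §5 (5.10) (chunk p0010) «First
suppose that `d_min = 2`. Then `X ∼ Y₁ × Y₂` where `Y₁` is a simple abelian surface and `Y₂` is a simple abelian
threefold. Note that `Y₁` is of CM-type with `Hg(Y₁) = U_{F₁}`, where `F₁ = End⁰(Y₁)`. If `Y₂` is not of CM-type then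
Lemma (3.6) readily gives `Hg(X) = Hg(Y₁) × Hg(Y₂)`» … «(as `F₁` does not contain an imaginary quadratic field)»;
§2 (2.3) (chunk p0005) type IV(1,1): `Hg(T) = U` with centre `U_{k''}` of rank one for `T` a simple threefold with
`End⁰(T) = k''` imaginary quadratic.

THIS FILE. §1 **`AVSlots.exists_coeff_eq_zero_off_balanced_of_prod_quadraticEnd_simpleCMSurface`** — the INVARIANCE
THEOREM for slots over `A × C`: `End⁰(A)` two-dimensional with `φ ≫ φ = -d` (skew centre of `End_Hdg(H¹(A))` is the line
`ℚφ^*`, R24's `quadraticEnd_skewCentre_data`), `C` a SIMPLE abelian surface realising a CM type `Φ` of the quartic CM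
field `K` on `H¹` (`IsCMTypeRealisation`): every rational `(p,p)`-class on `X` with slots over `A × C` has a letter
expansion vanishing off the `A`-kind-balanced words — the tree's `RankOneCentreTimesCMCurveInvariance` §3 verbatim with
(i) the `C`-letters the `K`-EIGENBASIS of `H¹(C) ⊗ ℂ` (`(i,0) ↦ v_{σᵢ}`, `σᵢ ∈ Φ`, type `(1,0)`; `(i,1) ↦ v_{σ̄ᵢ}`, type
`(0,1)`; `BettiUniverse.cmEndAction`, `CommonReflex.exists_basis_mem_eigenline_complexify`), (ii) the Lie step
`wordDerAt_incl_theta_proj_eq_zero_of_rankOneCentre_times_qSimpleTorus` with `𝔲 = (K⁻)^*`, a `K`-COMPATIBLE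
polarization `Q^K` of `H¹(C)` (`EndAction.IsPolarizable.exists_isCompatible`), (COMM) from
`EndAction.mem_spanC_map_of_commute_of_skew`, (NOSQ) from `mul_self_ne_algebraMap_of_isSimple_of_isCMTypeRealisation`,
and (QS) — «`hg(X₂)` does not contain a proper algebraic Lie subalgebra» on the tensor at hand — from the word-model
transfer `wordDerAt_toMatrix_eq_zero_of_forall_weight` (the operators `ι₂ z^* π₂` are diagonal in the eigen-letters with
weights `σ(z)`) and the Galois statement `QuarticCM.sum_mul_apply_eq_zero_of_skew`. §2 the PRODUCT SPAN
`HodgeClassesProductSpan B Z` for slots over `A × C` and its equal-powers form; §3 CONDITION (D): `A` stably nondegenerate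
⟹ `A × C`, `C × A` stably nondegenerate (`IsStablyNondegenerate.prod_simpleCMSurface_of_quadraticEnd`; a simple surface
is (D)). §4 **THE ROW (5.10)**: for a SIMPLE abelian surface `S` OF CM TYPE and a SIMPLE abelian threefold `T` of type
IV NOT of CM type (`dim_ℚ End⁰(T) = 2`), `S × T` is stably nondegenerate —
**`isStablyNondegenerate_simpleCMSurface_prod_threefold_of_typeIV_of_not_isOfCMType`**, EXACTLY the displayed hypothesis
`hST` of `Summit.HodgeConjecture.Ring2.NonSimpleFivefolds.isStablyNondegenerate_of_dim_eq_five_of_not_isSimple_of`, now a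
theorem (`S ∼ S'` CM-typed by `Milne1999.exists_isCMTyped_isIsogenous_of_isSimple`; `T` is (D) by the tree's
`AbelianVariety.isStablyNondegenerate_of_isSimple_threefold_of_finrank_eq_two`); with the Hodge conjecture for all powers
and everything isogenous.

## References

* [MoonenZarhin1999LowDim] B. Moonen, Yu. Zarhin, Math. Ann. 315 (1999), Thm. 0.2 (4), §2 (2.3), §3 (3.1), Thm. (3.2),
  Lemma (3.6), §5 (5.10) (held `paper:arxiv-math_9901113` chunks p0001–p0002, p0005–p0007, p0010). [cite: MoonenZarhin1999LowDim, §3 Lemma (3.6) and §5 (5.10)]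
* [Deligne1982HodgeCycles] P. Deligne, LNM 900 (1982), I §3 Prop. 3.4, Prop. 3.6, §4. [cite: Deligne1982HodgeCycles, I §3 Prop. 3.6]
* [Lombardo2016] D. Lombardo, Ann. Inst. Fourier 66 (2016), Lemma 3.4 (p. 1229). [cite: Lombardo2016, Lemma 3.4 (p. 1229)]
* [Gordon1999HodgeAVSurvey] B. B. Gordon, App. B in Lewis' *Survey of the Hodge conjecture* (1999), Thm. 7.5, Def. 7.6. [cite: Gordon1999HodgeAVSurvey, Thm. 7.5 and Def. 7.6]
* [Shimura1998] G. Shimura, *Abelian Varieties with Complex Multiplication and Modular Functions* (1998), §5.2, §8.4 (2). [cite: Shimura1998, §5.2]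
* [vanGeemen1994HodgeAV] B. van Geemen, LNM 1594 (1994), §2.4, Lemma 3.7, §3.6, Lemma 5.2. [cite: vanGeemen1994HodgeAV, Lemma 3.7]
* [MumfordAV1970] D. Mumford, *Abelian Varieties*, §21. [cite: MumfordAV1970, §21]
* [VoisinHodgeI2002] C. Voisin, *Hodge Theory I*, §7.1.1. [cite: VoisinHodgeI2002, §7.1.1]
-/

noncomputable section

open scoped TensorProduct
open CategoryTheory Module NumberField

namespace Literature.AlgebraicGeometry.HodgeTheory

open Literature.AlgebraicTopology.SingularHomology
open Literature.AlgebraicGeometry.Motives (IsSmoothProjective AbelianVariety bettiCohomology CMType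
  ofRatClassBaseChange ofRatClassBaseChange_tmul HodgeTensorFacts hodgeTensorFacts_holds ComplexPoints)
open Literature.Barriers.HodgeConjecture
open Literature.AlgebraicGeometry.Motives.HodgeStructure
open Literature.AlgebraicGeometry.Motives.AbelianVariety
open Literature.AlgebraicGeometry.ComplexMultiplication
open Literature.AlgebraicGeometry.Milne1999
open Literature.AlgebraicGeometry.Pohlmann1968
open Literature.NumberTheory.ComplexMultiplication
open Literature.RepresentationTheory.GeneralLinear
open Literature.NumberTheory.DiophantineGeometry

/-! ### §1 The invariance theorem for slots over `A × S` -/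

section Invariance

variable {A C X : AbelianVariety ℂ} {n : ℕ} {g : Fin n → (X ⟶ A.prod C)}

/-- The two elements of `Fin 2`. [folklore] -/
private theorem fin2_eq_zero_or_one_cs (r : Fin 2) : r = 0 ∨ r = 1 := by
  fin_cases r <;> simp

set_option maxHeartbeats 400000 in
open scoped Classical in
/-- **The INVARIANCE THEOREM for slots over `A × C`, `End⁰(A) = ℚ(φ)` imaginary quadratic (`φ ≫ φ = -d`: a centre
of rank ONE), `C` a SIMPLE abelian surface with complex multiplication by the quartic CM field `K`** (Moonen–Zarhin
1999 Lemma (3.6), Lie step: «If `Hg(X) ≠ Hg(X₁) × Hg(X₂)` then the center of `Hg(X₁)` contains an algebraic torus which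
is `ℚ`-isogenous to `Hg(X₂)`» — impossible for `Hg(X₂) = U_K` of dimension `2`, `ℚ`-simple, against a centre of rank
`≤ 1`; row (5.10) «If `Y₂` is not of CM-type then Lemma (3.6) readily gives `Hg(X) = Hg(Y₁) × Hg(Y₂)`»). Conclusion =
the tree's `AVSlots.exists_coeff_eq_zero_off_balanced_of_prod_quadraticEnd_cmCurve`: Hodge-adapted pair bases of
`H¹(A) ⊗ ℂ` and `H¹(C) ⊗ ℂ` (the latter the `K`-EIGENBASIS `v_σ`, `σ ∈ Φ` of type `(1,0)`, `σ̄` of type `(0,1)`) such that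
every rational `(p,p)`-class on `X` (slots `g` over `A × C`) has a letter expansion whose coefficient function VANISHES
off the `A`-kind-balanced words. Proof = the tree's proof verbatim with the Lie step
`wordDerAt_incl_theta_proj_eq_zero_of_rankOneCentre_times_qSimpleTorus`, whose `V₂`-hypotheses are supplied by
`EndAction.mem_spanC_map_of_commute_of_skew` (COMM, compatible polarization `Q^K`),
`mul_self_ne_algebraMap_of_isSimple_of_isCMTypeRealisation` (NOSQ) and the word-model transfer
`wordDerAt_toMatrix_eq_zero_of_forall_weight` + `QuarticCM.sum_mul_apply_eq_zero_of_skew` (QS).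
[cite: MoonenZarhin1999LowDim, §3 Lemma (3.6) and §5 (5.10)] [cite: MoonenZarhin1999LowDim, §3 (3.1)]
[cite: Deligne1982HodgeCycles, I §3 Prop. 3.4 and Prop. 3.6] [cite: Lombardo2016, Lemma 3.4 (p. 1229)] -/
theorem AVSlots.exists_coeff_eq_zero_off_balanced_of_prod_quadraticEnd_simpleCMSurface (hg : AVSlots (A.prod C) X g)
    (hA0 : 0 < A.dim) (hA2 : Module.finrank ℚ A.endAlgebra = 2) (φA : A ⟶ A) {d : ℕ} (hd : 0 < d)
    (hφA : φA ≫ φA = -(d • 𝟙 A))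
    {K : Type} [Field K] [NumberField K] [IsCMField K] {Φ : CMType K} {ιC : 𝓞 K →+* End C}
    {θ : K →+* Module.End ℂ (complexBetti C.X 1)} (hreal : IsCMTypeRealisation Φ C ιC θ)
    (hK4 : Module.finrank ℚ K = 4) (hCs : C.IsSimple) :
    ∃ (hA : ℕ) (bA : Module.Basis (Fin hA × Fin 2) ℂ (ℂ ⊗[ℚ] bettiCohomology A.X 1))
      (cC : Module.Basis (Fin 2 × Fin 2) ℂ (ℂ ⊗[ℚ] bettiCohomology C.X 1)),
      (∀ i, IsOfHodgeType A.dim A.X 1 1 0 (ofRatClassBaseChange (Motives.ComplexPoints A.X) 1 (bA (i, 0)))) ∧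
      (∀ i, IsOfHodgeType A.dim A.X 1 0 1 (ofRatClassBaseChange (Motives.ComplexPoints A.X) 1 (bA (i, 1)))) ∧
      (∀ i, IsOfHodgeType C.dim C.X 1 1 0 (ofRatClassBaseChange (Motives.ComplexPoints C.X) 1 (cC (i, 0)))) ∧
      (∀ i, IsOfHodgeType C.dim C.X 1 0 1 (ofRatClassBaseChange (Motives.ComplexPoints C.X) 1 (cC (i, 1)))) ∧
      ∀ {p : ℕ}, 0 < p → ∀ {c : complexBetti X.X (2 * p)}, IsRationalClass c →
        IsOfHodgeType X.dim X.X (2 * p) p p c →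
        ∃ a : (Fin (2 * p) → (Fin n × (Fin hA ⊕ Fin 2)) × Fin 2) → ℂ,
          wordEval (cupPowOneAlt ℂ (Motives.ComplexPoints X.X) (2 * p))
            (fun jr : (Fin n × (Fin hA ⊕ Fin 2)) × Fin 2 => complexBetti.map (g jr.1.1).hom.hom.hom 1
              (Sum.elim
                (fun i => complexBetti.map (Motives.AbelianVariety.fst A C).hom.hom.hom 1
                  (ofRatClassBaseChange (Motives.ComplexPoints A.X) 1 (bA (i, jr.2))))
                (fun i => complexBetti.map (Motives.AbelianVariety.snd A C).hom.hom.hom 1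
                  (ofRatClassBaseChange (Motives.ComplexPoints C.X) 1 (cC (i, jr.2))))
                jr.1.2)) a = c ∧
          ∀ (U : Fin (2 * p) → Fin n × (Fin hA ⊕ Fin 2)) (η : Fin (2 * p) → Fin 2),
            (∑ t, Sum.elim (fun _ : Fin hA => if η t = 0 then (1 : ℂ) else -1) (fun _ : Fin 2 => (0 : ℂ)) (U t).2) ≠ 0 →
            a (fun t => (U t, η t)) = 0 := by
  classical
  -- the setting
  have hHD : exists_isReal_hodgeModel := exists_isReal_hodgeModel_holds
  have hI : hodgePQ_independent_of_hodgeModel := hodgePQ_independent_of_hodgeModel_holds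
  haveI : HodgeTensorFacts.{0, 0} := hodgeTensorFacts_holds.{0, 0}
  have hXA : IsSmoothProjective A.dim A.X := AbelianVariety.isSmoothProjective_holds
  have hXC : IsSmoothProjective C.dim C.X := AbelianVariety.isSmoothProjective_holds
  have hXP : IsSmoothProjective (A.prod C).dim (A.prod C).X := AbelianVariety.isSmoothProjective_holds
  haveI : Module.Finite ℚ (bettiCohomology A.X 1) := finite_bettiCohomology_one A
  haveI : Module.Finite ℚ (bettiCohomology C.X 1) := finite_bettiCohomology_one C
  haveI : Module.Finite ℚ (bettiCohomology (A.prod C).X 1) := finite_bettiCohomology_one (A.prod C)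
  have hn1 : (((1 : ℕ) : ℤ)) = 1 := by norm_num
  -- the pair bases of `H¹(A) ⊗ ℂ` and `H¹(C) ⊗ ℂ`
  obtain ⟨hA, bA, hbA0, hbA1⟩ := exists_hodgeAdapted_pairBasis (BettiUniverse.hodge hHD hXA 1) (by norm_num)
    (BettiUniverse.hodge_isEffective hHD hXA 1)
  have hbA0' : ∀ i, bA (i, 0) ∈ (BettiUniverse.hodge hHD hXA 1).piece 1 0 := fun i => by simpa using hbA0 i
  have hbA1' : ∀ i, bA (i, 1) ∈ (BettiUniverse.hodge hHD hXA 1).piece 0 1 := fun i => by simpa using hbA1 i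
  -- the `K`-action on `H¹(C; ℚ)`, its eigenbasis, and the pair indexing `(i, 0) ↦ σᵢ ∈ Φ`, `(i, 1) ↦ σ̄ᵢ`
  have hθ : BettiUniverse.IsInducedOnIntegers θ := hreal.isInducedOnIntegers
  set Acm := BettiUniverse.cmEndAction θ hθ hHD hI hXC with hAcm
  obtain ⟨bK, hbK⟩ := CommonReflex.exists_basis_mem_eigenline_complexify hreal hθ
  have hbKmem : ∀ σ : K →+* ℂ, bK σ ∈ ⨅ e : K, Module.End.eigenspace ((Acm.ι e).baseChange ℂ) (σ e) :=
    fun σ => hbK σ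
  have hbKev : ∀ (σ : K →+* ℂ) (e : K), (Acm.ι e).baseChange ℂ (bK σ) = σ e • bK σ :=
    fun σ e => (Acm.mem_iInf_eigenspace_iff σ _).1 (hbKmem σ) e
  have hdimK : Module.finrank ℚ K / 2 = C.dim := by
    rw [finrank_eq_two_mul_dim_of_isCMTypeRealisation hreal]; omega
  have hbK10 : ∀ σ ∈ Φ.1, bK σ ∈ (BettiUniverse.hodge hHD hXC 1).piece 1 0 := by
    intro σ hσ
    refine (BettiUniverse.mem_hodge_piece_iff hHD hI hXC (k := 1) (p := 1) (q := 0) rfl _).2 ?_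
    have h10 := (hreal.2.2.2 σ).2.1 hσ _ (BettiUniverse.ofRatClassBaseChange_mem_eigenline θ hθ hHD hI hXC σ (hbKmem σ))
    rwa [hdimK] at h10
  have hbK01 : ∀ σ ∉ Φ.1, bK σ ∈ (BettiUniverse.hodge hHD hXC 1).piece 0 1 := by
    intro σ hσ
    refine (BettiUniverse.mem_hodge_piece_iff hHD hI hXC (k := 1) (p := 0) (q := 1) rfl _).2 ?_
    have h01 := (hreal.2.2.2 σ).2.2 hσ _ (BettiUniverse.ofRatClassBaseChange_mem_eigenline θ hθ hHD hI hXC σ (hbKmem σ))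
    rwa [hdimK] at h01
  -- `Φ = {x, y}`, the four embeddings `x, y, x̄, ȳ`
  obtain ⟨σ₀⟩ : Nonempty (K →+* ℂ) := inferInstance
  obtain ⟨x, hx⟩ : ∃ x : K →+* ℂ, x ∈ Φ.1 :=
    (CMTypeOps.mem_or_conjugate_mem Φ σ₀).elim (fun h0 => ⟨_, h0⟩) (fun h0 => ⟨_, h0⟩)
  obtain ⟨y, hyx, hyx', hΦ⟩ := exists_eq_pair_of_finrank_eq_four hK4 Φ hx
  set e0 : Fin 2 → (K →+* ℂ) := ![x, y] with he0
  have he0mem : ∀ i, e0 i ∈ Φ.1 := fun i => by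
    rcases fin2_eq_zero_or_one_cs i with h0 | h1
    · rw [h0]; exact hx
    · rw [h1, hΦ]; exact Or.inr rfl
  have he0inj : Function.Injective e0 := by
    intro i j hij
    rcases fin2_eq_zero_or_one_cs i with hi | hi <;> rcases fin2_eq_zero_or_one_cs j with hj | hj <;> subst hi <;> subst hj
    · rfl
    · exact absurd hij.symm hyx
    · exact absurd hij hyx
    · rfl
  set emb : Fin 2 × Fin 2 → (K →+* ℂ) :=
    fun ir => if ir.2 = 0 then e0 ir.1 else ComplexEmbedding.conjugate (e0 ir.1) with hemb
  have hemb0eq : ∀ i, emb (i, 0) = e0 i := fun i => if_pos rfl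
  have hemb1eq : ∀ i, emb (i, 1) = ComplexEmbedding.conjugate (e0 i) := fun i => if_neg one_ne_zero
  have hemb0 : ∀ i, emb (i, 0) ∈ Φ.1 := fun i => by rw [hemb0eq]; exact he0mem i
  have hemb1 : ∀ i, emb (i, 1) ∉ Φ.1 := fun i => by
    rw [hemb1eq]; exact (CMTypeOps.mem_iff_conjugate_notMem Φ _).1 (he0mem i)
  have hembinj : Function.Injective emb := by
    rintro ⟨i, r⟩ ⟨j, t⟩ hij
    rcases fin2_eq_zero_or_one_cs r with hr | hr <;> rcases fin2_eq_zero_or_one_cs t with ht | ht <;> subst hr <;> subst ht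
    · rw [hemb0eq, hemb0eq] at hij
      rw [he0inj hij]
    · exact absurd (hemb0 i) (by rw [hij]; exact hemb1 j)
    · exact absurd (hemb0 j) (by rw [← hij]; exact hemb1 i)
    · rw [hemb1eq, hemb1eq] at hij
      rw [he0inj ((ComplexEmbedding.involutive_conjugate K).injective hij)]
  have hembbij : Function.Bijective emb := by
    rw [Fintype.bijective_iff_injective_and_card]
    refine ⟨hembinj, ?_⟩
    rw [Fintype.card_prod, Fintype.card_fin, Embeddings.card, hK4]
  set fK : Fin 2 × Fin 2 ≃ (K →+* ℂ) := Equiv.ofBijective emb hembbij with hfK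
  set cC : Module.Basis (Fin 2 × Fin 2) ℂ (ℂ ⊗[ℚ] bettiCohomology C.X 1) := bK.reindex fK.symm with hcCdef
  have hcC : ∀ ir, cC ir = bK (emb ir) := fun ir => by
    rw [hcCdef, Module.Basis.reindex_apply, Equiv.symm_symm, hfK, Equiv.ofBijective_apply]
  have hcCev : ∀ ir (e : K), (Acm.ι e).baseChange ℂ (cC ir) = (emb ir) e • cC ir := fun ir e => by
    rw [hcC]; exact hbKev _ e
  have hcC0' : ∀ i, cC (i, 0) ∈ (BettiUniverse.hodge hHD hXC 1).piece 1 0 := fun i => by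
    rw [hcC]; exact hbK10 _ (hemb0 i)
  have hcC1' : ∀ i, cC (i, 1) ∈ (BettiUniverse.hodge hHD hXC 1).piece 0 1 := fun i => by
    rw [hcC]; exact hbK01 _ (hemb1 i)
  -- `K⁻`, the operators `𝔲 = (K⁻)^*`, a compatible polarization, the eigenline condition, (NOSQ)
  obtain ⟨S, hS⟩ : ∃ S : Submodule ℚ K, ∀ z : K, z ∈ S ↔ IsCMField.complexConj K z = -z :=
    ⟨{ carrier := {z | IsCMField.complexConj K z = -z}
       add_mem' := fun {a b} ha hb => by
         simp only [Set.mem_setOf_eq] at ha hb ⊢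
         rw [map_add, ha, hb, neg_add]
       zero_mem' := by simp
       smul_mem' := fun c z hz => by
         simp only [Set.mem_setOf_eq] at hz ⊢
         rw [map_rat_smul, hz, smul_neg] }, fun z => Iff.rfl⟩
  set 𝔲 : Submodule ℚ (Module.End ℚ (bettiCohomology C.X 1)) := S.map Acm.ι.toLinearMap with h𝔲
  have hpolC : (BettiUniverse.hodge hHD (AbelianVariety.isSmoothProjective_holds (A := C)) 1).IsPolarizable :=
    smoothProjective_hodgeStructure_isPolarizable_holds hXC (BettiUniverse.realHodgeModel hHD hXC)
      (BettiUniverse.realHodgeModel_isHodgeSymmetric hHD hXC) 1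
  obtain ⟨ψC, hcompat⟩ := EndAction.IsPolarizable.exists_isCompatible Acm hpolC
  have hline : ∀ σ : K →+* ℂ,
      Module.finrank ℂ ↥(⨅ e : K, Module.End.eigenspace ((Acm.ι e).baseChange ℂ) (σ e)) = 1 :=
    fun σ => BettiUniverse.finrank_eigenLine_eq_one θ hθ hHD hI hXC σ (hreal.2.2.2 σ).1
  have hnosqK : ∀ z : K, IsCMField.complexConj K z = -z → z ≠ 0 → ∀ r : ℚ, z * z ≠ algebraMap ℚ K r :=
    fun z hz hz0 r => mul_self_ne_algebraMap_of_isSimple_of_isCMTypeRealisation hK4 hreal hCs hz hz0 r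
  haveI : Nontrivial (bettiCohomology C.X 1) := by
    apply Module.nontrivial_of_finrank_pos (R := ℚ)
    rw [finrank_bettiCohomology_one C, ← hdimK, hK4]
    norm_num
  refine ⟨hA, bA, cC, fun i => ?_, fun i => ?_, fun i => ?_, fun i => ?_, ?_⟩
  · exact (BettiUniverse.mem_hodge_piece_iff hHD hI hXA (k := 1) (p := 1) (q := 0) rfl _).1 (hbA0' i)
  · exact (BettiUniverse.mem_hodge_piece_iff hHD hI hXA (k := 1) (p := 0) (q := 1) rfl _).1 (hbA1' i)
  · exact (BettiUniverse.mem_hodge_piece_iff hHD hI hXC (k := 1) (p := 1) (q := 0) rfl _).1 (hcC0' i)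
  · exact (BettiUniverse.mem_hodge_piece_iff hHD hI hXC (k := 1) (p := 0) (q := 1) rfl _).1 (hcC1' i)
  intro p hp c hcQ hc
  -- the presentation `H¹(A × C) = pr_A^* H¹(A) ⊕ pr_C^* H¹(C)` and its complexification
  set ι₁ := HOneProduct.pullFst A C with hι₁
  set π₁ := HOneProduct.pullInl A C with hπ₁
  set ι₂ := HOneProduct.pullSnd A C with hι₂
  set π₂ := HOneProduct.pullInr A C with hπ₂
  have hπι₁ : π₁ ∘ₗ ι₁ = LinearMap.id := HOneProduct.pullInl_comp_pullFst
  have hπι₂ : π₂ ∘ₗ ι₂ = LinearMap.id := HOneProduct.pullInr_comp_pullSnd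
  have hπ₁ι₂ : π₁ ∘ₗ ι₂ = 0 := HOneProduct.pullInl_comp_pullSnd
  have hπ₂ι₁ : π₂ ∘ₗ ι₁ = 0 := HOneProduct.pullInr_comp_pullFst
  have hsum : ι₁ ∘ₗ π₁ + ι₂ ∘ₗ π₂ = LinearMap.id := HOneProduct.pullFst_comp_pullInl_add
  have hπι₁C : π₁.baseChange ℂ ∘ₗ ι₁.baseChange ℂ = LinearMap.id := by
    rw [← LinearMap.baseChange_comp, hπι₁, LinearMap.baseChange_id]
  have hπι₂C : π₂.baseChange ℂ ∘ₗ ι₂.baseChange ℂ = LinearMap.id := by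
    rw [← LinearMap.baseChange_comp, hπι₂, LinearMap.baseChange_id]
  have hπ₁ι₂C : π₁.baseChange ℂ ∘ₗ ι₂.baseChange ℂ = 0 := by
    rw [← LinearMap.baseChange_comp, hπ₁ι₂, LinearMap.baseChange_zero]
  have hπ₂ι₁C : π₂.baseChange ℂ ∘ₗ ι₁.baseChange ℂ = 0 := by
    rw [← LinearMap.baseChange_comp, hπ₂ι₁, LinearMap.baseChange_zero]
  have hsumC : ι₁.baseChange ℂ ∘ₗ π₁.baseChange ℂ + ι₂.baseChange ℂ ∘ₗ π₂.baseChange ℂ = LinearMap.id := by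
    rw [← LinearMap.baseChange_comp, ← LinearMap.baseChange_comp, ← LinearMap.baseChange_add, hsum,
      LinearMap.baseChange_id]
  -- piece compatibility of `pr_A^*`, `pr_C^*` (pull-backs are morphisms of Hodge structures)
  have hι₁F : ∀ q : ℤ, ∀ x ∈ (BettiUniverse.hodge hHD hXA 1).piece q (((1 : ℕ) : ℤ) - q), ι₁.baseChange ℂ x ∈ (BettiUniverse.hodge hHD hXP 1).piece q (((1 : ℕ) : ℤ) - q) :=
    fun q x hx => (BettiUniverse.pullHodgeHom hHD hI hXP hXA (Motives.AbelianVariety.fst A C).hom.hom.hom 1).map_piece_le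
      q _ ⟨x, hx, rfl⟩
  have hι₂F : ∀ q : ℤ, ∀ x ∈ (BettiUniverse.hodge hHD hXC 1).piece q (((1 : ℕ) : ℤ) - q), ι₂.baseChange ℂ x ∈ (BettiUniverse.hodge hHD hXP 1).piece q (((1 : ℕ) : ℤ) - q) :=
    fun q x hx => (BettiUniverse.pullHodgeHom hHD hI hXP hXC (Motives.AbelianVariety.snd A C).hom.hom.hom 1).map_piece_le
      q _ ⟨x, hx, rfl⟩
  -- §1: the basis `cbx` of `H¹(A × C) ⊗ ℂ` in pairs: `pr_A^* b_i^r` and `pr_C^* c_i^r`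
  obtain ⟨cbx', hcbx'l, hcbx'r⟩ := exists_basis_of_presentation hπι₁C hπι₂C hπ₁ι₂C hπ₂ι₁C hsumC bA cC
  set cbx : Module.Basis ((Fin hA ⊕ Fin 2) × Fin 2) ℂ (ℂ ⊗[ℚ] bettiCohomology (A.prod C).X 1) :=
    cbx'.reindex (Equiv.sumProdDistrib (Fin hA) (Fin 2) (Fin 2)).symm with hcbxdef
  have hcbx : ∀ tr : (Fin hA ⊕ Fin 2) × Fin 2, cbx tr =
      Sum.elim (fun i => ι₁.baseChange ℂ (bA (i, tr.2))) (fun i => ι₂.baseChange ℂ (cC (i, tr.2))) tr.1 := by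
    rintro ⟨t, r⟩
    rw [hcbxdef, Module.Basis.reindex_apply, Equiv.symm_symm]
    rcases t with i | i
    · rw [Equiv.sumProdDistrib_apply_left, hcbx'l]; rfl
    · rw [Equiv.sumProdDistrib_apply_right, hcbx'r]; rfl
  -- Hodge-adaptedness of `cbx`
  have hcbx0 : ∀ t, cbx (t, 0) ∈ (BettiUniverse.hodge hHD hXP 1).piece 1 0 := by
    intro t
    rw [hcbx]
    rcases t with i | i
    · exact hι₁F 1 _ (by simpa using hbA0' i)
    · exact hι₂F 1 _ (by simpa using hcC0' i)
  have hcbx1 : ∀ t, cbx (t, 1) ∈ (BettiUniverse.hodge hHD hXP 1).piece 0 1 := by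
    intro t
    rw [hcbx]
    rcases t with i | i
    · have e : (((1 : ℕ) : ℤ) - 0) = 1 := by norm_num
      have h01 := hι₁F 0 _ (by rw [e]; exact hbA1' i)
      rwa [e] at h01
    · have e : (((1 : ℕ) : ℤ) - 0) = 1 := by norm_num
      have h01 := hι₂F 0 _ (by rw [e]; exact hcC1' i)
      rwa [e] at h01
  -- bases indexed by `Fin M`: the pair basis `cbσ` and the rational basis `eC`
  set eQ := Module.finBasis ℚ (bettiCohomology (A.prod C).X 1) with heQ
  set eC : Module.Basis (Fin (Module.finrank ℚ (bettiCohomology (A.prod C).X 1))) ℂ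
    (ℂ ⊗[ℚ] bettiCohomology (A.prod C).X 1) := Algebra.TensorProduct.basis ℂ eQ with heC
  set φ : Fin (Module.finrank ℚ (bettiCohomology (A.prod C).X 1)) ≃ (Fin hA ⊕ Fin 2) × Fin 2 :=
    eC.indexEquiv cbx with hφ
  set cbσ : Module.Basis (Fin (Module.finrank ℚ (bettiCohomology (A.prod C).X 1))) ℂ
    (ℂ ⊗[ℚ] bettiCohomology (A.prod C).X 1) := cbx.reindex φ.symm with hcbσdef
  have hcbσ : ∀ m, cbσ m = cbx (φ m) := fun m => by
    rw [hcbσdef, Module.Basis.reindex_apply, Equiv.symm_symm]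
  -- letters
  set ρ := ofRatClassBaseChangeEquiv hXP 1 with hρ
  set v : Module.Basis _ ℂ (complexBetti (A.prod C).X 1) := cbσ.map ρ with hv
  set eL : Module.Basis _ ℂ (complexBetti (A.prod C).X 1) := eC.map ρ with heL
  have heLQ : ∀ i, IsRationalClass (eL i) := fun i => by
    rw [heL, Module.Basis.map_apply, heC, Algebra.TensorProduct.basis_apply, hρ,
      ofRatClassBaseChangeEquiv_apply, ofRatClassBaseChange_tmul, one_smul]
    exact isRationalClass_ofRatClass _
  set κ : Fin (Module.finrank ℚ (bettiCohomology (A.prod C).X 1)) → Fin 2 := fun m => (φ m).2 with hκ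
  have hv_apply : ∀ m, v m = ofRatClassBaseChange (Motives.ComplexPoints (A.prod C).X) 1 (cbx (φ m)) := fun m => by
    rw [hv, Module.Basis.map_apply, hcbσ, hρ, ofRatClassBaseChangeEquiv_apply]
  have hv0 : ∀ m, κ m = 0 → IsOfHodgeType (A.prod C).dim (A.prod C).X 1 1 0 (v m) := by
    intro m hm
    rw [hv_apply, ← BettiUniverse.mem_hodge_piece_iff hHD hI hXP (k := 1) (p := 1) (q := 0) rfl]
    have hsplit : φ m = ((φ m).1, 0) := by
      change (φ m).2 = 0 at hm; rw [← hm]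
    rw [hsplit]
    exact hcbx0 _
  have hv1 : ∀ m, κ m = 1 → IsOfHodgeType (A.prod C).dim (A.prod C).X 1 0 1 (v m) := by
    intro m hm
    rw [hv_apply, ← BettiUniverse.mem_hodge_piece_iff hHD hI hXP (k := 1) (p := 0) (q := 1) rfl]
    have hsplit : φ m = ((φ m).1, 1) := by
      change (φ m).2 = 1 at hm; rw [← hm]
    rw [hsplit]
    exact hcbx1 _
  -- (α) an antisymmetric kind-balanced coefficient function in the adapted letters
  obtain ⟨ax, hax_bal, hax_anti, hcax⟩ := hg.exists_antisymm_kindBalanced_wordEval_eq v κ hv0 hv1 hp hc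
  -- the change of letters to the rational letters
  set G : Matrix _ _ ℂ := eC.toMatrix cbσ with hG
  set G' : Matrix _ _ ℂ := cbσ.toMatrix eC with hG'
  have hG'G : G' * G = 1 := cbσ.toMatrix_mul_toMatrix_flip eC
  have hve : ∀ m, v m = ∑ i, G i m • eL i := fun m => by
    simp only [hv, heL, Module.Basis.map_apply, ← map_smul, ← map_sum]
    congr 1
    exact (eC.sum_toMatrix_smul_self (v := ⇑cbσ) (j := m)).symm
  have hletters : ∀ j m, avLetters g v (j, m) = ∑ i, G i m • avLetters g eL (j, i) :=
    avLetters_baseChange g G hve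
  set aE := colourChangeAt (fun _ : Fin n => G) ax with haE
  have haE_anti : IsAntisymm aE := hax_anti.colourChangeAt _
  have hcaE : wordEval (cupPowOneAlt ℂ (Motives.ComplexPoints X.X) (2 * p)) (avLetters g eL) aE = c := by
    rw [haE, ← wordEval_eq_wordEval_colourChangeAt _ (fun _ : Fin n => G) hletters ax, hcax]
  -- rationality of `aE`
  have hFinj : Function.Injective (exteriorPower.alternatingMapLinearEquiv
      (cupPowOneAlt ℂ (Motives.ComplexPoints X.X) (2 * p))) :=
    injective_alternatingMapLinearEquiv_cupPowOneAlt X (2 * p)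
  obtain ⟨q, hq⟩ := hg.exists_rat_wordEval_eq eL heLQ hcQ
  obtain ⟨q', -, haEq⟩ := haE_anti.exists_eq_algebraMap_of_wordEval_eq hFinj (hg.letterBasis eL)
    (q := q) (by rw [AVSlots.coe_letterBasis, hcaE, hq])
  have hslice_e : ∀ u, wordSlice aE u = wordRepAt ℂ (fun _ : Fin (2 * p) => G) (wordSlice ax u) :=
    fun u => wordSlice_colourChangeAt (fun _ : Fin n => G) ax u
  -- the Hodge operator `Θ` of `H¹(A × C)`: `diag(±1)` in the adapted letters
  obtain ⟨Θ, hΘ⟩ := exists_hodgeTheta (BettiUniverse.hodge hHD hXP 1)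
  have hΘb : ∀ m, Θ (cbσ m) = (if κ m = 0 then (1 : ℂ) else -1) • cbσ m := by
    intro m
    rw [hcbσ]
    change Θ _ = (if (φ m).2 = 0 then (1 : ℂ) else -1) • _
    rcases fin2_eq_zero_or_one_cs (φ m).2 with h0 | h1
    · rw [h0, if_pos rfl]
      have hmem : cbx (φ m) ∈ (BettiUniverse.hodge hHD hXP 1).piece 1 (((1 : ℕ) : ℤ) - 1) := by
        have e : (((1 : ℕ) : ℤ) - 1) = 0 := by norm_num
        have hsplit : φ m = ((φ m).1, 0) := by rw [← h0]
        rw [e, hsplit]; exact hcbx0 _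
      rw [hΘ 1 _ hmem]
      norm_num
    · rw [h1, if_neg one_ne_zero]
      have hmem : cbx (φ m) ∈ (BettiUniverse.hodge hHD hXP 1).piece 0 (((1 : ℕ) : ℤ) - 0) := by
        have e : (((1 : ℕ) : ℤ) - 0) = 1 := by norm_num
        have hsplit : φ m = ((φ m).1, 1) := by rw [← h1]
        rw [e, hsplit]; exact hcbx1 _
      rw [hΘ 0 _ hmem]
      norm_num
  have hΘcb : LinearMap.toMatrix cbσ cbσ Θ = kindDiag κ := by
    ext i m
    rw [LinearMap.toMatrix_apply, hΘb, map_smul, Module.Basis.repr_self, Finsupp.smul_apply,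
      Finsupp.single_apply, kindDiag, Matrix.diagonal_apply, smul_eq_mul, mul_ite, mul_one, mul_zero]
    by_cases him : i = m
    · subst him; rw [if_pos rfl]
    · rw [if_neg (Ne.symm him), if_neg him]
  have hJG : LinearMap.toMatrix eC eC Θ * G = G * kindDiag κ := by
    rw [← hΘcb, hG, linearMap_toMatrix_mul_basis_toMatrix, basis_toMatrix_mul_linearMap_toMatrix]
  have hΘq : ∀ u : Fin (2 * p) → Fin n, wordDerAt ℂ (fun _ : Fin (2 * p) => LinearMap.toMatrix eC eC Θ)
      (wordSlice (fun w => algebraMap ℚ ℂ (q' w)) u) = 0 := by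
    intro u
    rw [← haEq, hslice_e]
    refine wordDerAt_wordRepAt_eq_zero_of_mul_eq ℂ (fun _ : Fin (2 * p) => G) (fun _ => hJG) ?_
    rw [wordDerAt_const]
    exact wordDer_kindDiag_wordSlice_eq_zero κ hax_bal u
  -- a polarization of `H¹(A)`
  obtain ⟨ψ⟩ : (BettiUniverse.hodge hHD (AbelianVariety.isSmoothProjective_holds (A := A)) 1).IsPolarizable :=
    smoothProjective_hodgeStructure_isPolarizable_holds hXA (BettiUniverse.realHodgeModel hHD hXA)
      (BettiUniverse.realHodgeModel_isHodgeSymmetric hHD hXA) 1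
  -- the Hodge operators `Θ_A`, `Θ_C` and the partial Hodge operator `Y = pr_A^* ∘ Θ_A ∘ ι_A^*`
  obtain ⟨ΘA, hΘA⟩ := exists_hodgeTheta (BettiUniverse.hodge hHD hXA 1)
  obtain ⟨ΘC, hΘC⟩ := exists_hodgeTheta (BettiUniverse.hodge hHD hXC 1)
  set Y := ι₁.baseChange ℂ ∘ₗ ΘA ∘ₗ π₁.baseChange ℂ with hY
  -- the `A`-side: `End_Hdg(H¹(A)) = ℚ + ℚφ^*`, skew centre `⊆ ℚφ^*`
  obtain ⟨-, -, hZ⟩ := quadraticEnd_skewCentre_data hHD hI hA0 hA2 hd hφA ψ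
  -- the `C`-side hypotheses of the Lie step
  have hfamE : ∀ e : K, (Acm.ι e : Module.End ℚ (bettiCohomology C.X 1)) ∈ (BettiUniverse.hodge hHD hXC 1).endAlg :=
    fun e => (Acm.hom e).toLinearMap_mem_endAlg
  have h𝔲fam : ∀ Y ∈ 𝔲, ∀ e : K, Y * Acm.ι e = Acm.ι e * Y := fun Y hY e => Acm.commute_ι_of_mem_map S hY e
  have h𝔲c : ∀ Y ∈ 𝔲, ∀ Y' ∈ 𝔲, Y * Y' = Y' * Y := fun Y hY Y' hY' => Acm.commute_of_mem_map S hY hY'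
  have h𝔲skew : ∀ Y ∈ 𝔲, ∀ v w, ψC.form (Y v) w + ψC.form v (Y w) = 0 :=
    fun Y hY v w => Acm.form_add_eq_zero_of_mem_map S hS hcompat hY v w
  have hcommC : ∀ Y : Module.End ℂ (ℂ ⊗[ℚ] bettiCohomology C.X 1),
      (∀ e : K, Y * (Acm.ι e).baseChange ℂ = (Acm.ι e).baseChange ℂ * Y) →
      (∀ x' y', ψC.form.baseChange ℂ (Y x') y' + ψC.form.baseChange ℂ x' (Y y') = 0) → Y ∈ spanC 𝔲 :=
    fun Y hYc hYs => Acm.mem_spanC_map_of_commute_of_skew S hS hline ψC hcompat hYc hYs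
  have hnosq : ∀ Y ∈ 𝔲, Y ≠ 0 → ∀ r : ℚ, Y * Y ≠ r • 1 :=
    fun Y hY hY0 r => Acm.mul_self_ne_smul_one_of_mem_map S hS hnosqK hY hY0 r
  -- (QS): the operators `ι₂ (z^*) π₂`, `z ∈ K`, are diagonal in the letters `cbσ` with weights `σ(z)` at the
  -- `C`-letters of eigen-type `σ` and `0` at the `A`-letters; the weights of a word are `Σ_σ n_σ σ(z)`, and the
  -- Galois argument `QuarticCM.sum_mul_apply_eq_zero_of_skew` transfers their vanishing from `z₁ ∈ K⁻ ∖ 0` to `K⁻`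
  obtain ⟨τ, hτ⟩ : ∃ τ : Fin (Module.finrank ℚ (bettiCohomology (A.prod C).X 1)) → Option (K →+* ℂ), ∀ m,
      τ m = Sum.elim (fun _ : Fin hA => none) (fun i : Fin 2 => some (emb (i, (φ m).2))) (φ m).1 :=
    ⟨_, fun m => rfl⟩
  have e22C : ∀ w, π₂.baseChange ℂ (ι₂.baseChange ℂ w) = w := fun w => by
    rw [← LinearMap.comp_apply (f := π₂.baseChange ℂ), hπι₂C, LinearMap.id_apply]
  have e21C : ∀ v, π₂.baseChange ℂ (ι₁.baseChange ℂ v) = 0 := fun v => by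
    rw [← LinearMap.comp_apply (f := π₂.baseChange ℂ), hπ₂ι₁C, LinearMap.zero_apply]
  have hdiag : ∀ (z : K) (m : Fin (Module.finrank ℚ (bettiCohomology (A.prod C).X 1))),
      (ι₂ ∘ₗ (Acm.ι z : Module.End ℚ (bettiCohomology C.X 1)) ∘ₗ π₂).baseChange ℂ (cbσ m) =
        (Option.elim (τ m) 0 fun σ : K →+* ℂ => σ z) • cbσ m := by
    intro z m
    rw [hcbσ, hcbx, hτ m]
    obtain ⟨t, r⟩ := φ m
    rcases t with i | i
    · simp only [Sum.elim_inl, Option.elim_none, zero_smul, LinearMap.baseChange_comp, LinearMap.comp_apply, e21C,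
        map_zero]
    · simp only [Sum.elim_inr, Option.elim_some, LinearMap.baseChange_comp, LinearMap.comp_apply, e22C, hcCev,
        map_smul]
  have hQS : ∀ y₁ ∈ 𝔲, y₁ ≠ 0 →
      (∀ u : Fin (2 * p) → Fin n, wordDerAt ℚ (fun _ : Fin (2 * p) => LinearMap.toMatrix eQ eQ (ι₂ ∘ₗ y₁ ∘ₗ π₂))
        (wordSlice q' u) = 0) →
      ∀ y ∈ 𝔲, ∀ u : Fin (2 * p) → Fin n,
        wordDerAt ℚ (fun _ : Fin (2 * p) => LinearMap.toMatrix eQ eQ (ι₂ ∘ₗ y ∘ₗ π₂)) (wordSlice q' u) = 0 := by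
    intro y₁ hy₁ hy₁0 hkill y hy
    obtain ⟨z₁, hz₁S, rfl⟩ := Submodule.mem_map.1 hy₁
    obtain ⟨z, hzS, rfl⟩ := Submodule.mem_map.1 hy
    have hz₁s : IsCMField.complexConj K z₁ = -z₁ := (hS z₁).1 hz₁S
    have hzs : IsCMField.complexConj K z = -z := (hS z).1 hzS
    have hz₁0 : z₁ ≠ 0 := by
      rintro rfl
      exact hy₁0 (by rw [map_zero])
    change ∀ u, wordDerAt ℚ (fun _ => LinearMap.toMatrix eQ eQ
      (ι₂ ∘ₗ (Acm.ι z₁ : Module.End ℚ (bettiCohomology C.X 1)) ∘ₗ π₂)) (wordSlice q' u) = 0 at hkill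
    change ∀ u, wordDerAt ℚ (fun _ => LinearMap.toMatrix eQ eQ
      (ι₂ ∘ₗ (Acm.ι z : Module.End ℚ (bettiCohomology C.X 1)) ∘ₗ π₂)) (wordSlice q' u) = 0
    have hkC := (forall_wordDerAt_baseChange_eq_zero_iff eQ q' _).2 hkill
    rw [← heC] at hkC
    have hδ : ∀ w : Word (Module.finrank ℚ (bettiCohomology (A.prod C).X 1)) (2 * p),
        ∑ t, Option.elim (τ (w t)) 0 (fun σ : K →+* ℂ => σ z₁) = 0 →
        ∑ t, Option.elim (τ (w t)) 0 (fun σ : K →+* ℂ => σ z) = 0 := by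
      intro w hw
      rw [sum_weight_eq_sum_card_mul τ (fun σ : K →+* ℂ => σ z₁) w] at hw
      rw [sum_weight_eq_sum_card_mul τ (fun σ : K →+* ℂ => σ z) w]
      have h0 : ∑ σ : K →+* ℂ, (((Finset.univ.filter fun t => τ (w t) = some σ).card : ℚ) : ℂ) * σ z₁ = 0 := by
        simpa only [Rat.cast_natCast] using hw
      have h1 := QuarticCM.sum_mul_apply_eq_zero_of_skew hK4
        (fun σ : K →+* ℂ => ((Finset.univ.filter fun t => τ (w t) = some σ).card : ℚ)) hz₁0 hz₁s
        (hnosqK z₁ hz₁s hz₁0) h0 hzs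
      simpa only [Rat.cast_natCast] using h1
    have hres : ∀ u, wordDerAt ℂ (fun _ : Fin (2 * p) => LinearMap.toMatrix eC eC
        ((ι₂ ∘ₗ (Acm.ι z : Module.End ℚ (bettiCohomology C.X 1)) ∘ₗ π₂).baseChange ℂ))
        (wordSlice (fun w => algebraMap ℚ ℂ (q' w)) u) = 0 := fun u =>
      wordDerAt_toMatrix_eq_zero_of_forall_weight eC cbσ (hdiag z₁) (hdiag z) hδ (hkC u)
    rw [heC] at hres
    exact (forall_wordDerAt_baseChange_eq_zero_iff eQ q' _).1 hres
  -- the product Lie step: `Y` kills the rational coefficient tensor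
  have hL : ∀ u : Fin (2 * p) → Fin n, wordDerAt ℂ (fun _ : Fin (2 * p) => LinearMap.toMatrix eC eC Y)
      (wordSlice (fun w => algebraMap ℚ ℂ (q' w)) u) = 0 := fun u =>
    wordDerAt_incl_theta_proj_eq_zero_of_rankOneCentre_times_qSimpleTorus hn1 (BettiUniverse.hodge hHD hXP 1)
      (BettiUniverse.hodge hHD hXA 1) (BettiUniverse.hodge hHD hXC 1) (BettiUniverse.hodge_isEffective hHD hXA 1)
      (BettiUniverse.hodge_isEffective hHD hXC 1) hπι₁ hπι₂ hπ₁ι₂ hπ₂ι₁ hsum hι₁F hι₂F ψ ψC hZ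
      (fun e : K => (Acm.ι e : Module.End ℚ (bettiCohomology C.X 1))) hfamE 𝔲 h𝔲fam h𝔲c h𝔲skew hcommC hnosq
      eQ q' hQS hΘ hΘA hΘC hΘq u
  -- the diagonal weights of `Y` in the pair letters: `±1` at the `A`-places, `0` at the `C`-places
  set δ₀ : Fin hA ⊕ Fin 2 → Fin 2 → ℂ :=
    Sum.elim (fun (_ : Fin hA) (r : Fin 2) => if r = 0 then (1 : ℂ) else -1) (fun (_ : Fin 2) (_ : Fin 2) => (0 : ℂ))
    with hδ₀
  set D : Fin hA ⊕ Fin 2 → Matrix (Fin 2) (Fin 2) ℂ := fun t => Matrix.diagonal (δ₀ t) with hD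
  have hYG : ∀ _t : Fin (2 * p), LinearMap.toMatrix eC eC Y * G = G * LinearMap.toMatrix cbσ cbσ Y :=
    fun _ => by rw [hG, linearMap_toMatrix_mul_basis_toMatrix, basis_toMatrix_mul_linearMap_toMatrix]
  have e11 : ∀ x, π₁.baseChange ℂ (ι₁.baseChange ℂ x) = x := fun x => by
    rw [← LinearMap.comp_apply (f := π₁.baseChange ℂ), hπι₁C, LinearMap.id_apply]
  have e12 : ∀ y, π₁.baseChange ℂ (ι₂.baseChange ℂ y) = 0 := fun y => by
    rw [← LinearMap.comp_apply (f := π₁.baseChange ℂ), hπ₁ι₂C, LinearMap.zero_apply]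
  -- `Θ_A` on the pair basis of `H¹(A) ⊗ ℂ`
  have hΘAb : ∀ (i : Fin hA) (r : Fin 2), ΘA (bA (i, r)) = (if r = 0 then (1 : ℂ) else -1) • bA (i, r) := by
    intro i r
    rcases fin2_eq_zero_or_one_cs r with h0 | h1
    · rw [h0, if_pos rfl]
      have hmem : bA (i, 0) ∈ (BettiUniverse.hodge hHD hXA 1).piece 1 (((1 : ℕ) : ℤ) - 1) := by
        have e : (((1 : ℕ) : ℤ) - 1) = 0 := by norm_num
        rw [e]; exact hbA0' i
      rw [hΘA 1 _ hmem]
      norm_num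
    · rw [h1, if_neg one_ne_zero]
      have hmem : bA (i, 1) ∈ (BettiUniverse.hodge hHD hXA 1).piece 0 (((1 : ℕ) : ℤ) - 0) := by
        have e : (((1 : ℕ) : ℤ) - 0) = 1 := by norm_num
        rw [e]; exact hbA1' i
      rw [hΘA 0 _ hmem]
      norm_num
  have hblk : LinearMap.toMatrix cbσ cbσ Y = blockLift φ D := by
    refine toMatrix_eq_blockLift_of_apply_basis φ cbσ _ Y fun m => ?_
    rw [hcbσ m]
    have hb' : ∀ a, cbσ (φ.symm ((φ m).1, a)) = cbx ((φ m).1, a) := fun a => by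
      rw [hcbσ, Equiv.apply_symm_apply]
    simp only [hb']
    obtain ⟨t, r⟩ := φ m
    rcases t with i | i
    · simp only [hcbx, Sum.elim_inl]
      rw [hY, LinearMap.comp_apply, LinearMap.comp_apply, e11, hΘAb, map_smul,
        Finset.sum_eq_single r]
      · rw [hD]
        simp only [hδ₀, Sum.elim_inl, Matrix.diagonal_apply_eq]
      · intro a _ ha
        rw [hD]
        simp only [Matrix.diagonal_apply_ne _ ha, zero_smul]
      · intro hr; exact absurd (Finset.mem_univ r) hr
    · simp only [hcbx, Sum.elim_inr]
      rw [hY, LinearMap.comp_apply, LinearMap.comp_apply, e12, map_zero, map_zero]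
      symm
      refine Finset.sum_eq_zero fun a _ => ?_
      have h0 : D (Sum.inr i) a r = 0 := by
        simp [hD, hδ₀, Matrix.diagonal_apply]
      rw [h0, zero_smul]
  -- `Y` kills the coefficient tensor in the pair letters
  have hax : ∀ u : Fin (2 * p) → Fin n, wordDerAt ℂ (fun _ : Fin (2 * p) => blockLift φ D) (wordSlice ax u) = 0 := by
    intro u
    have hLu := hL u
    rw [← haEq, hslice_e] at hLu
    have h3 : wordRepAt ℂ (fun _ : Fin (2 * p) => G)
        (wordDerAt ℂ (fun _ : Fin (2 * p) => blockLift φ D) (wordSlice ax u)) = 0 := by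
      rw [← hblk, wordRepAt_wordDerAt_of_mul_eq ℂ (fun _ : Fin (2 * p) => G) hYG, hLu]
    exact wordRepAt_injective ℂ (g := fun _ : Fin (2 * p) => G) (g' := fun _ : Fin (2 * p) => G')
      (funext fun _ => hG'G) (by rw [h3, map_zero])
  -- the coefficient function, refined to slot-and-place colours
  refine ⟨placeRefine φ ax, ?_, fun U η hU => ?_⟩
  · rw [← hcax]
    have hx : (fun jr : (Fin n × (Fin hA ⊕ Fin 2)) × Fin 2 => avLetters g v (jr.1.1, φ.symm (jr.1.2, jr.2))) =
        fun jr : (Fin n × (Fin hA ⊕ Fin 2)) × Fin 2 => complexBetti.map (g jr.1.1).hom.hom.hom 1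
          (Sum.elim
            (fun i => complexBetti.map (Motives.AbelianVariety.fst A C).hom.hom.hom 1
              (ofRatClassBaseChange (Motives.ComplexPoints A.X) 1 (bA (i, jr.2))))
            (fun i => complexBetti.map (Motives.AbelianVariety.snd A C).hom.hom.hom 1
              (ofRatClassBaseChange (Motives.ComplexPoints C.X) 1 (cC (i, jr.2))))
            jr.1.2) := by
      funext jr
      rw [avLetters_apply, hv_apply, Equiv.apply_symm_apply, hcbx]
      obtain ⟨⟨j, t⟩, r⟩ := jr
      rcases t with i | i
      · simp only [Sum.elim_inl]
        congr 1
        rw [hι₁, ← ofRatClassBaseChangeEquiv_apply (hX := hXP), ← ofRatClassBaseChangeEquiv_apply (hX := hXA),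
          complexBetti_map_ofRatClassBaseChangeEquiv hXP hXA]
      · simp only [Sum.elim_inr]
        congr 1
        rw [hι₂, ← ofRatClassBaseChangeEquiv_apply (hX := hXP), ← ofRatClassBaseChangeEquiv_apply (hX := hXC),
          complexBetti_map_ofRatClassBaseChangeEquiv hXP hXC]
    rw [← hx]
    exact wordEval_placeRefine _ φ (avLetters g v) ax
  · -- the blocks of `Y` placed by place kill the refined slices; read off the diagonal weights
    have h1 := wordDerAt_placeFamily_placeRefine_eq_zero φ D hax U
    have h2 : wordDerAt ℂ (fun t => Matrix.diagonal (δ₀ (U t).2)) (wordSlice (placeRefine φ ax) U) = 0 := h1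
    have h3 := eq_zero_of_wordDerAt_diagonal_eq_zero (fun t => δ₀ (U t).2) h2 η (by
      have hsum_eq : ∑ t, δ₀ (U t).2 (η t) =
          ∑ t, Sum.elim (fun _ : Fin hA => if η t = 0 then (1 : ℂ) else -1) (fun _ : Fin 2 => (0 : ℂ)) (U t).2 := by
        refine Finset.sum_congr rfl fun t _ => ?_
        rw [hδ₀]
        exact sum_elim_kindWeight_apply (U t).2 (η t)
      rw [hsum_eq]; exact hU)
    rw [wordSlice_apply] at h3
    exact h3


end Invariance

/-! ### §2 The product span for `A × C`, `End⁰(A)` imaginary quadratic, `C` a simple CM surface -/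

section ProductSpanOpens

open MonoidalCategory CartesianMonoidalCategory

section ProductSpan

variable {A B C Z : AbelianVariety ℂ} {n : ℕ} {gB : Fin n → (B ⟶ A)} {gC : Fin n → (Z ⟶ C)}

/-- **`HodgeClassesProductSpan B Z` for slots over `A × C`, `End⁰(A) = ℚ(φ)` imaginary quadratic, `C` a simple
abelian surface with complex multiplication by the quartic `K`** (Moonen–Zarhin (3.1) with Lemma (3.6), PROVED with
slots: `B` with `n` slots over `A`, `Z` with `n` slots over `C`, e.g. `B = A^{N+1}`, `Z = C^{N+1}`): every rational
class of Hodge type `(p,p)` on `B × Z` is a `ℂ`-combination of exterior products `pr_B^* a ⌣ pr_Z^* b` of RATIONAL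
HODGE classes — the tree's `hodgeClassesProductSpan_of_avSlots_of_quadraticEnd_cmCurve` verbatim, fed by §1.
[cite: MoonenZarhin1999LowDim, §3 (3.1) and Lemma (3.6)] [cite: Lombardo2016, Lemma 3.4 (p. 1229)] -/
theorem hodgeClassesProductSpan_of_avSlots_of_quadraticEnd_simpleCMSurface
    (hA0 : 0 < A.dim) (hA2 : Module.finrank ℚ A.endAlgebra = 2) (φA : A ⟶ A) {d : ℕ} (hd : 0 < d)
    (hφA : φA ≫ φA = -(d • 𝟙 A))
    {K : Type} [Field K] [NumberField K] [IsCMField K] {Φ : CMType K} {ιC : 𝓞 K →+* End C}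
    {θ : K →+* Module.End ℂ (complexBetti C.X 1)} (hreal : IsCMTypeRealisation Φ C ιC θ)
    (hK4 : Module.finrank ℚ K = 4) (hCs : C.IsSimple)
    (hgB : AVSlots A B gB) (hgC : AVSlots C Z gC) :
    HodgeClassesProductSpan B Z := by
  classical
  intro p c hcQ hc
  have hB : IsSmoothProjective B.dim B.X := Motives.AbelianVariety.isSmoothProjective_holds
  have hZ : IsSmoothProjective Z.dim Z.X := Motives.AbelianVariety.isSmoothProjective_holds
  have hXA : IsSmoothProjective A.dim A.X := Motives.AbelianVariety.isSmoothProjective_holds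
  have hXC : IsSmoothProjective C.dim C.X := Motives.AbelianVariety.isSmoothProjective_holds
  obtain ⟨hA, bA, cC, hbA0, hbA1, hcC0, hcC1, hmain⟩ :=
    (hgB.prodLift hgC).exists_coeff_eq_zero_off_balanced_of_prod_quadraticEnd_simpleCMSurface hA0 hA2 φA hd hφA hreal hK4 hCs
  have hc' : IsOfHodgeType (B.prod Z).dim (B.prod Z).X (2 * p) p p c := by
    rw [Motives.AbelianVariety.dim_prod]; exact hc
  rcases Nat.eq_zero_or_pos p with rfl | hp
  · -- degree `0`: `c = s · 1 = pr_B^*(s · 1_B) ⌣ pr_Z^* 1_Z`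
    have h1 : c ∈ Submodule.span ℂ {singularCohomology.one ℂ (ComplexPoints (B.X ⊗ Z.X))} :=
      mem_divisorClassesSpan_zero (N := B.dim + Z.dim) (IsSmoothProjective.tensor_holds hB hZ) c
    obtain ⟨s, hs⟩ := Submodule.mem_span_singleton.1 h1
    refine mem_span_hodgeProductClasses_of_mem_span_pureType B Z hcQ hc (Submodule.subset_span ?_)
    refine ⟨0, 0, rfl, s • singularCohomology.one ℂ (ComplexPoints B.X), singularCohomology.one ℂ (ComplexPoints Z.X),
      ⟨0, rfl, isOfHodgeType_zero_zero_of_degree_zero hB _⟩,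
      ⟨0, 0, rfl, isOfHodgeType_zero_zero_of_degree_zero hZ _⟩, ?_⟩
    rw [← hs, map_smul, LinearMap.map_smul₂]
    erw [singularCohomology.map_one, singularCohomology.map_one, cupProduct_one]
  · obtain ⟨a, hca, hkill⟩ := hmain hp hcQ hc'
    -- the letters of `B × Z` over `A × C` are `pr_B^*`(letters of `B` over `A`) and `pr_Z^*`(letters of `Z` over `C`)
    set xA : (Fin n × Fin hA) × Fin 2 → complexBetti B.X 1 := fun jr =>
      complexBetti.map (gB jr.1.1).hom.hom.hom 1 (ofRatClassBaseChange (ComplexPoints A.X) 1 (bA (jr.1.2, jr.2)))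
      with hxA
    set y : (Fin n × Fin 2) × Fin 2 → complexBetti Z.X 1 := fun jr =>
      complexBetti.map (gC jr.1.1).hom.hom.hom 1 (ofRatClassBaseChange (ComplexPoints C.X) 1 (cC (jr.1.2, jr.2)))
      with hy
    have hletters : (fun jr : (Fin n × (Fin hA ⊕ Fin 2)) × Fin 2 => complexBetti.map
        (Motives.AbelianVariety.prodLift (Motives.AbelianVariety.fst B Z ≫ gB jr.1.1)
          (Motives.AbelianVariety.snd B Z ≫ gC jr.1.1)).hom.hom.hom 1
        (Sum.elim
          (fun i => complexBetti.map (Motives.AbelianVariety.fst A C).hom.hom.hom 1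
            (ofRatClassBaseChange (ComplexPoints A.X) 1 (bA (i, jr.2))))
          (fun i => complexBetti.map (Motives.AbelianVariety.snd A C).hom.hom.hom 1
            (ofRatClassBaseChange (ComplexPoints C.X) 1 (cC (i, jr.2))))
          jr.1.2)) =
        fun jr : (Fin n × (Fin hA ⊕ Fin 2)) × Fin 2 => Sum.elim
          (fun i => complexBetti.map (Motives.AbelianVariety.fst B Z).hom.hom.hom 1 (xA ((jr.1.1, i), jr.2)))
          (fun i => complexBetti.map (Motives.AbelianVariety.snd B Z).hom.hom.hom 1 (y ((jr.1.1, i), jr.2)))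
          jr.1.2 := by
      funext jr
      obtain ⟨⟨j, t⟩, κ⟩ := jr
      rcases t with i | i
      · simp only [Sum.elim_inl, hxA]
        rw [complexBetti_map_map_hom, complexBetti_map_map_hom, Motives.AbelianVariety.prodLift_fst]
      · simp only [Sum.elim_inr, hy]
        rw [complexBetti_map_map_hom, complexBetti_map_map_hom, Motives.AbelianVariety.prodLift_snd]
    -- types of the letters
    have hxA0 : ∀ jr : (Fin n × Fin hA) × Fin 2, jr.2 = 0 → IsOfHodgeType B.dim B.X 1 1 0 (xA jr) := by
      rintro ⟨⟨j, i⟩, κ⟩ hκ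
      change κ = 0 at hκ
      subst hκ
      exact (hbA0 i).map_of_isSmoothProjective hB hXA _
    have hxA1 : ∀ jr : (Fin n × Fin hA) × Fin 2, jr.2 = 1 → IsOfHodgeType B.dim B.X 1 0 1 (xA jr) := by
      rintro ⟨⟨j, i⟩, κ⟩ hκ
      change κ = 1 at hκ
      subst hκ
      exact (hbA1 i).map_of_isSmoothProjective hB hXA _
    have hy0 : ∀ jr : (Fin n × Fin 2) × Fin 2, jr.2 = 0 → IsOfHodgeType Z.dim Z.X 1 1 0 (y jr) := by
      rintro ⟨⟨j, i⟩, κ⟩ hκ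
      change κ = 0 at hκ
      subst hκ
      exact (hcC0 i).map_of_isSmoothProjective hZ hXC _
    have hy1 : ∀ jr : (Fin n × Fin 2) × Fin 2, jr.2 = 1 → IsOfHodgeType Z.dim Z.X 1 0 1 (y jr) := by
      rintro ⟨⟨j, i⟩, κ⟩ hκ
      change κ = 1 at hκ
      subst hκ
      exact (hcC1 i).map_of_isSmoothProjective hZ hXC _
    -- evaluate and feed the typed criterion
    have hmem := wordEval_mem_span_typed_cup_pureType_of_eq_zero_off_balanced
      (Motives.AbelianVariety.fst B Z) (Motives.AbelianVariety.snd B Z) xA y hxA0 hxA1 hy0 hy1 hkill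
    rw [← hletters, hca] at hmem
    refine mem_span_hodgeProductClasses_of_mem_span_pureType B Z hcQ hc (Submodule.span_mono ?_ hmem)
    rintro z ⟨i, j, hij, d, μ, hd, hμ, rfl⟩
    exact ⟨i, j, hij, d, μ, hd, hμ, rfl⟩

/-- **Equal powers**: `HodgeClassesProductSpan (A^{N+1}) (C^{N+1})` (by slots `AVSlots.powSucc` on both sides).
[cite: MoonenZarhin1999LowDim, §3 (3.1) and Lemma (3.6)] [cite: Lombardo2016, Lemma 3.4 (p. 1229)] -/
theorem hodgeClassesProductSpan_powSucc_powSucc_of_quadraticEnd_simpleCMSurface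
    (hA0 : 0 < A.dim) (hA2 : Module.finrank ℚ A.endAlgebra = 2) (φA : A ⟶ A) {d : ℕ} (hd : 0 < d)
    (hφA : φA ≫ φA = -(d • 𝟙 A))
    {K : Type} [Field K] [NumberField K] [IsCMField K] {Φ : CMType K} {ιC : 𝓞 K →+* End C}
    {θ : K →+* Module.End ℂ (complexBetti C.X 1)} (hreal : IsCMTypeRealisation Φ C ιC θ)
    (hK4 : Module.finrank ℚ K = 4) (hCs : C.IsSimple)
    (N : ℕ) : HodgeClassesProductSpan (A.powSucc N) (C.powSucc N) :=
  hodgeClassesProductSpan_of_avSlots_of_quadraticEnd_simpleCMSurface hA0 hA2 φA hd hφA hreal hK4 hCs (AVSlots.powSucc A N) (AVSlots.powSucc C N)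

/-- One slot on each side: `HodgeClassesProductSpan A C`. [cite: MoonenZarhin1999LowDim, §3 (3.1) and Lemma (3.6)] -/
theorem hodgeClassesProductSpan_of_quadraticEnd_simpleCMSurface
    (hA0 : 0 < A.dim) (hA2 : Module.finrank ℚ A.endAlgebra = 2) (φA : A ⟶ A) {d : ℕ} (hd : 0 < d)
    (hφA : φA ≫ φA = -(d • 𝟙 A))
    {K : Type} [Field K] [NumberField K] [IsCMField K] {Φ : CMType K} {ιC : 𝓞 K →+* End C}
    {θ : K →+* Module.End ℂ (complexBetti C.X 1)} (hreal : IsCMTypeRealisation Φ C ιC θ)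
    (hK4 : Module.finrank ℚ K = 4) (hCs : C.IsSimple) :
    HodgeClassesProductSpan A C :=
  hodgeClassesProductSpan_of_avSlots_of_quadraticEnd_simpleCMSurface hA0 hA2 φA hd hφA hreal hK4 hCs (avSlots_self A) (avSlots_self C)

end ProductSpan

end ProductSpanOpens

/-! ### §3 Condition (D) for `A × C` -/

section ConditionD

variable {A C : AbelianVariety ℂ}

/-- **Condition (D) for `A × C`**: if `A` (with `End⁰(A)` imaginary quadratic) is stably nondegenerate and `C` is a
simple CM surface (quartic `K`), then `A × C` is stably nondegenerate («`Hg(X) = Hg(Y₁) × Hg(Y₂)`» and Thm. (3.2):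
product span on all equal powers + (D) for both factors; a simple abelian surface is (D), the tree's
`AbelianVariety.isStablyNondegenerate_of_isSimple_surface`). [cite: MoonenZarhin1999LowDim, §3 Thm. (3.2), Lemma (3.6) and §5 (5.10)]
[cite: Gordon1999HodgeAVSurvey, Def. 7.6] -/
theorem IsStablyNondegenerate.prod_simpleCMSurface_of_quadraticEnd (hA : IsStablyNondegenerate A)
    (hA0 : 0 < A.dim) (hA2 : Module.finrank ℚ A.endAlgebra = 2) (φA : A ⟶ A) {d : ℕ} (hd : 0 < d)
    (hφA : φA ≫ φA = -(d • 𝟙 A))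
    {K : Type} [Field K] [NumberField K] [IsCMField K] {Φ : CMType K} {ιC : 𝓞 K →+* End C}
    {θ : K →+* Module.End ℂ (complexBetti C.X 1)} (hreal : IsCMTypeRealisation Φ C ιC θ)
    (hK4 : Module.finrank ℚ K = 4) (hCs : C.IsSimple) : IsStablyNondegenerate (A.prod C) := by
  have hC2 : C.dim = 2 := by
    have h := finrank_eq_two_mul_dim_of_isCMTypeRealisation hreal
    omega
  exact isStablyNondegenerate_prod_of_forall_productSpan_powSucc A C
    (fun N => hodgeClassesProductSpan_powSucc_powSucc_of_quadraticEnd_simpleCMSurface hA0 hA2 φA hd hφA hreal hK4 hCs N) hA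
    (AbelianVariety.isStablyNondegenerate_of_isSimple_surface C hCs hC2)

/-- The order `C × A`. [cite: MoonenZarhin1999LowDim, §3 Thm. (3.2) and Lemma (3.6)] -/
theorem IsStablyNondegenerate.simpleCMSurface_prod_of_quadraticEnd (hA : IsStablyNondegenerate A)
    (hA0 : 0 < A.dim) (hA2 : Module.finrank ℚ A.endAlgebra = 2) (φA : A ⟶ A) {d : ℕ} (hd : 0 < d)
    (hφA : φA ≫ φA = -(d • 𝟙 A))
    {K : Type} [Field K] [NumberField K] [IsCMField K] {Φ : CMType K} {ιC : 𝓞 K →+* End C}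
    {θ : K →+* Module.End ℂ (complexBetti C.X 1)} (hreal : IsCMTypeRealisation Φ C ιC θ)
    (hK4 : Module.finrank ℚ K = 4) (hCs : C.IsSimple) : IsStablyNondegenerate (C.prod A) :=
  (hA.prod_simpleCMSurface_of_quadraticEnd hA0 hA2 φA hd hφA hreal hK4 hCs).of_isIsogenous (isIsogenous_prod_swap C A)

end ConditionD

/-! ### §4 The row (5.10): `S_CM × T`, `S` a simple CM surface, `T` a simple threefold of type IV not of CM type -/

section RowST

variable {S T : AbelianVariety ℂ}

/-- **THE ROW (5.10) with `dim_ℚ End⁰(T) = 2` (Moonen–Zarhin Thm. 0.2 (4) for `S × T`)**: for a SIMPLE abelian surface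
`S` OF CM TYPE and a SIMPLE abelian threefold `T` with `dim_ℚ End⁰(T) = 2` (type IV(1,1), not of CM type), `S × T` is
stably nondegenerate — `B•(Xⁿ) = D•(Xⁿ)` for all `n`. (`S ∼ S'` a realisation of a CM type of a quartic CM field,
`Milne1999.exists_isCMTyped_isIsogenous_of_isSimple`; `T` is (D), the tree's
`AbelianVariety.isStablyNondegenerate_of_isSimple_threefold_of_finrank_eq_two`; §3 for `T × S'`; isogeny invariance.)
«If `Y₂` is not of CM-type then Lemma (3.6) readily gives `Hg(X) = Hg(Y₁) × Hg(Y₂)`.»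
[cite: MoonenZarhin1999LowDim, Thm. 0.2 (4), §3 Lemma (3.6) and §5 (5.10)] [cite: Gordon1999HodgeAVSurvey, Def. 7.6] -/
theorem isStablyNondegenerate_simpleCMSurface_prod_of_isSimple_threefold_of_finrank_eq_two (hS2 : S.dim = 2)
    (hS : S.IsSimple) (hScm : IsOfCMType S) (hT : T.IsSimple) (hT3 : T.dim = 3)
    (hT2 : Module.finrank ℚ T.endAlgebra = 2) : IsStablyNondegenerate (S.prod T) := by
  obtain ⟨φ, d, hd, hφ⟩ := exists_hom_comp_self_eq_neg_of_isSimple_threefold_of_finrank_eq_two hT hT3 hT2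
  have hTD : IsStablyNondegenerate T :=
    AbelianVariety.isStablyNondegenerate_of_isSimple_threefold_of_finrank_eq_two T hT hT3 hT2
  obtain ⟨S', hS't, hSS'⟩ := exists_isCMTyped_isIsogenous_of_isSimple S hS (by omega) hScm
  obtain ⟨ΦK, _, ιS, θS, hS'⟩ := hS't
  rename_i K _ _ _
  have hdS' : S'.dim = 2 := by
    obtain ⟨f, hf⟩ := hSS'
    rw [← dim_eq_of_isIsogeny hf, hS2]
  have hK : Module.finrank ℚ K = 4 := by rw [finrank_eq_two_mul_dim_of_isCMTypeRealisation hS', hdS']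
  have hS's : S'.IsSimple := hS.of_isIsogenous hSS'
  have hTS' : IsStablyNondegenerate (S'.prod T) :=
    hTD.simpleCMSurface_prod_of_quadraticEnd (by omega) hT2 φ hd hφ hS' hK hS's
  exact hTS'.of_isIsogenous (hSS'.prod (AbelianVariety.IsIsogenous.refl T))

/-- **THE ROW (5.10) in the spelling «`T` of type IV and NOT of CM type»** (`¬ HasNoTypeIVFactor T ∧ ¬ IsOfCMType T`):
for a simple threefold `dim_ℚ End⁰(T) ∈ {1, 2, 3, 6}`; `1` and `3` have no factor of type IV, `6` is CM type, so
`dim_ℚ End⁰(T) = 2`. This is EXACTLY the displayed hypothesis `hST` of the cell's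
`Summit.HodgeConjecture.Ring2.NonSimpleFivefolds.isStablyNondegenerate_of_dim_eq_five_of_not_isSimple_of`.
[cite: MoonenZarhin1999LowDim, Thm. 0.2 (4), §2 (2.3) and §5 (5.10)] [cite: MumfordAV1970, §21] -/
theorem isStablyNondegenerate_simpleCMSurface_prod_threefold_of_typeIV_of_not_isOfCMType (hS2 : S.dim = 2)
    (hS : S.IsSimple) (hScm : IsOfCMType S) (hT3 : T.dim = 3) (hT : T.IsSimple) (hTcm : ¬ IsOfCMType T)
    (hT4 : ¬ HasNoTypeIVFactor T) : IsStablyNondegenerate (S.prod T) := by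
  rcases AbelianVariety.finrank_endAlgebra_mem_of_isSimple_threefold hT hT3 with h1 | h2 | h3 | h6
  · exact absurd (hasNoTypeIVFactor_of_finrank_endAlgebra_eq_one h1) hT4
  · exact isStablyNondegenerate_simpleCMSurface_prod_of_isSimple_threefold_of_finrank_eq_two hS2 hS hScm hT hT3 h2
  · exact absurd (hasNoTypeIVFactor_of_isSimple_threefold_of_finrank_eq_three hT hT3 h3) hT4
  · exact absurd (isOfCMType_of_isSimple_threefold_of_finrank_eq_six hT hT3 h6) hTcm

/-- The order `T × S`. [cite: MoonenZarhin1999LowDim, Thm. 0.2 (4) and §5 (5.10)] -/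
theorem isStablyNondegenerate_threefold_of_typeIV_of_not_isOfCMType_prod_simpleCMSurface (hS2 : S.dim = 2)
    (hS : S.IsSimple) (hScm : IsOfCMType S) (hT3 : T.dim = 3) (hT : T.IsSimple) (hTcm : ¬ IsOfCMType T)
    (hT4 : ¬ HasNoTypeIVFactor T) : IsStablyNondegenerate (T.prod S) :=
  (isStablyNondegenerate_simpleCMSurface_prod_threefold_of_typeIV_of_not_isOfCMType hS2 hS hScm hT3 hT hTcm hT4).of_isIsogenous
    (isIsogenous_prod_swap T S)

/-- `B = D` on every power `(S × T)^{N+1}`. [cite: MoonenZarhin1999LowDim, Thm. 0.2 (4) and §5 (5.10)] -/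
theorem isDivisorGenerated_powSucc_simpleCMSurface_prod_threefold_of_typeIV_of_not_isOfCMType (hS2 : S.dim = 2)
    (hS : S.IsSimple) (hScm : IsOfCMType S) (hT3 : T.dim = 3) (hT : T.IsSimple) (hTcm : ¬ IsOfCMType T)
    (hT4 : ¬ HasNoTypeIVFactor T) (N : ℕ) : IsDivisorGenerated ((S.prod T).powSucc N) :=
  isStablyNondegenerate_simpleCMSurface_prod_threefold_of_typeIV_of_not_isOfCMType hS2 hS hScm hT3 hT hTcm hT4 N

/-- **The Hodge conjecture for every power `(S × T)^{N+1}`** of the row (5.10) — UNCONDITIONALLY (no HC_CM).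
[cite: MoonenZarhin1999LowDim, Thm. 0.2 (4) and §5 (5.10)] [cite: vanGeemen1994HodgeAV, §2.4 and Lemma 3.7] -/
theorem hodgeConjectureFor_powSucc_simpleCMSurface_prod_threefold_of_typeIV_of_not_isOfCMType (hS2 : S.dim = 2)
    (hS : S.IsSimple) (hScm : IsOfCMType S) (hT3 : T.dim = 3) (hT : T.IsSimple) (hTcm : ¬ IsOfCMType T)
    (hT4 : ¬ HasNoTypeIVFactor T) (N : ℕ) :
    HodgeConjectureFor ((S.prod T).powSucc N).dim ((S.prod T).powSucc N).X :=
  (isStablyNondegenerate_simpleCMSurface_prod_threefold_of_typeIV_of_not_isOfCMType hS2 hS hScm hT3 hT hTcm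
    hT4).hodgeConjectureFor_powSucc N

/-- **The Hodge conjecture for the abelian FIVEFOLD `S × T` of the row (5.10) itself.**
[cite: MoonenZarhin1999LowDim, Thm. 0.2 (4) and §5 (5.10)] -/
theorem hodgeConjectureFor_simpleCMSurface_prod_threefold_of_typeIV_of_not_isOfCMType (hS2 : S.dim = 2)
    (hS : S.IsSimple) (hScm : IsOfCMType S) (hT3 : T.dim = 3) (hT : T.IsSimple) (hTcm : ¬ IsOfCMType T)
    (hT4 : ¬ HasNoTypeIVFactor T) : HodgeConjectureFor (S.prod T).dim (S.prod T).X :=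
  (isStablyNondegenerate_simpleCMSurface_prod_threefold_of_typeIV_of_not_isOfCMType hS2 hS hScm hT3 hT hTcm
    hT4).hodgeConjectureFor

/-- **Everything isogenous to `S × T`** (van Geemen Lemma 3.7) is stably nondegenerate.
[cite: MoonenZarhin1999LowDim, Thm. 0.2 (4) and §5 (5.10)] [cite: vanGeemen1994HodgeAV, Lemma 3.7 and §3.6] -/
theorem isStablyNondegenerate_of_isIsogenous_simpleCMSurface_prod_threefold_of_typeIV_of_not_isOfCMType
    (hS2 : S.dim = 2) (hS : S.IsSimple) (hScm : IsOfCMType S) (hT3 : T.dim = 3) (hT : T.IsSimple)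
    (hTcm : ¬ IsOfCMType T) (hT4 : ¬ HasNoTypeIVFactor T) {X : AbelianVariety ℂ}
    (hX : AbelianVariety.IsIsogenous X (S.prod T)) : IsStablyNondegenerate X :=
  (isStablyNondegenerate_simpleCMSurface_prod_threefold_of_typeIV_of_not_isOfCMType hS2 hS hScm hT3 hT hTcm
    hT4).of_isIsogenous hX

/-- The Hodge conjecture for everything isogenous to a power of `S × T`. [cite: MoonenZarhin1999LowDim, Thm. 0.2 (4) and §5 (5.10)]
[cite: vanGeemen1994HodgeAV, Lemma 3.7] -/
theorem hodgeConjectureFor_of_isIsogenous_powSucc_simpleCMSurface_prod_threefold_of_typeIV_of_not_isOfCMType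
    (hS2 : S.dim = 2) (hS : S.IsSimple) (hScm : IsOfCMType S) (hT3 : T.dim = 3) (hT : T.IsSimple)
    (hTcm : ¬ IsOfCMType T) (hT4 : ¬ HasNoTypeIVFactor T) {X : AbelianVariety ℂ} {N : ℕ}
    (hX : AbelianVariety.IsIsogenous X ((S.prod T).powSucc N)) : HodgeConjectureFor X.dim X.X :=
  (isStablyNondegenerate_simpleCMSurface_prod_threefold_of_typeIV_of_not_isOfCMType hS2 hS hScm hT3 hT hTcm
    hT4).hodgeConjectureFor_of_isIsogenous_powSucc hX

/- **On path**: the Hodge conjecture gives every target of this file — the tree's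
`hodgeConjectureFor_prod_of_hodgeConjecture'` (`ThetaTraceTimesCMProductSpan`), not re-declared (gate dedup). -/
example (h : ∀ ⦃n : ℕ⦄ ⦃X : Motives.SchemeOver ℂ⦄, Motives.IsSmoothProjective n X → HodgeConjectureFor n X)
    (S T : AbelianVariety ℂ) : HodgeConjectureFor (S.prod T).dim (S.prod T).X :=
  hodgeConjectureFor_prod_of_hodgeConjecture' h S T

end RowST

end Literature.AlgebraicGeometry.HodgeTheory

end
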